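import Literature.MathematicalPhysics.QuantumFieldTheory.Balaban1983to89.B14Eq12Locality
import Literature.MathematicalPhysics.QuantumFieldTheory.BalabanImbrieJaffe1984to88.BIJ85Eq453GaugeField

/-!
# `Balaban1983to89.B14Eq12LocalityQsstar` — T. Bałaban, *Convergent renormalization expansions for lattice gauge theories*,
# Commun. Math. Phys. **119** (1988) 243–285 [Balaban1988Convergent]: the locality of `Q₁^{s*}` — item (c) of the three
# localities behind *"The function in (1.2) depends on the field V restricted to □′^{∼4}"* (p. 246) — made CONCRETE and
# PROVED for the printed (1.3) = (4.5.3) [18] on the `PBond` carrier (`BIJ85Eq453GaugeField.qsstarG`)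

statement-level skeleton of published theorems with citation tags; proofs where landed; nothing here is a claim about the Yang–Mills mass gap

PDF held: `paper:balaban1988-cmp119-convergent-renormalization` (journal page = PDF page + 242); p. 246 [PDF 4] read on the x2 render
`…-p004-x2.png` of `run/shared/lean/pub/pub-balaban/b2b-balaban-ref1/pages/1988-cmp119-convergent-renormalization/`.

CITATION HEADER (lean-in-tree rule).  WHAT IS REPRODUCED, verbatim, p. 246 [PDF 4]: *"Let us recall the definition
(Q₁^{s*}V)(b) = 1 for b ⊂ B(y), y ∈ T^{(1)};  = V(c) for b ∈ B(c) = {b : b₋ ∈ B(c₋), b₊ ∈ B(c₊)}, c ∈ T^{(1)}. (1.3)"* and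
*"The function in (1.2) depends on the field V restricted to □′^{∼4}."*  SKELETON rows **B14.Eq1.2** / **B14.Eq1.3** (owner
r11).  `B14Eq12Locality.u1locDependsOn_of_local` (p248823) proves the sentence from three localities (a) `hU`, (b) `hM`, (c) `hQ`
stated as hypotheses on the abstract `Sect1Data`; `BIJ85Eq453GaugeField.qsstarG` (p248815, p31) is (1.3) with a body on the same
carrier.  THIS FILE discharges (c): by (1.3) the value `(Q₁^{s*}V)(b)` is `1` or `V(c)` for the ONE coarse bond `c = ⟨B(b₋), μ(b)⟩`
whose corridor contains `b` — so `Q₁^{s*}V` on any set `S` of fine bonds is determined by `V` on the coarse bonds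
`{⟨blockOf b₋, μ(b)⟩ : b ∈ S not interior to a block}` (`qsstarG_local`), and for a `Sect1Data` whose `Qsstar` IS `qsstarG` the
sentence holds with `vars □′ =` those coarse bonds of the fine region of `□′^{∼4}` (`u1locDependsOn_of_qsstarG`), hence for any
larger bond set, e.g. all `T^{(1)}`-bonds of `□′^{∼4}` (`u1locDependsOn_mono`, `u1locDependsOn_of_qsstarG_of_subset`).  Localities
(a) (the minimizer `U(𝐁, ·)` of [15]) and (b) (the averaging `M˙`) remain the hypotheses of `u1locDependsOn_of_local` — their data
are abstract fields of `Sect1Data`.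

Mega-formalization `lit-balaban`, unit `lit-balaban-r11` gen 4 (B14 fold owner), HOME `run/shared/lean/pub/lit-balaban/`.

## References
* [Balaban1988Convergent] T. Bałaban, Commun. Math. Phys. 119 (1988) 243–285, (1.2)–(1.3) p. 246.
* [BalabanImbrieJaffe1985] T. Bałaban, J. Imbrie, A. Jaffe, Commun. Math. Phys. 97 (1985) 299–329, (4.5.3) p. 312 ([18]).
-/

namespace Literature.MathematicalPhysics.QuantumFieldTheory.Balaban1983to89.B14.Eq12LocalityQsstar

open Literature.MathematicalPhysics.QuantumFieldTheory.Balaban1983to89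
open Literature.MathematicalPhysics.QuantumFieldTheory.Balaban1983to89.B14.Sect1Repr
open Literature.MathematicalPhysics.QuantumFieldTheory.Balaban1983to89.B14.Eq12Locality
open Literature.MathematicalPhysics.QuantumFieldTheory.BalabanImbrieJaffe1984to88.BIJ85Eq453GaugeField

variable {P : Params} {G : Type*}

/-! ## §1. Locality of (1.3) -/

/-- **(1.3) is local**: `(Q^{s*}V)(b)` is `1` (b interior to a block) or `V⟨blockOf b₋, μ(b)⟩` (b in a corridor), so on any set `S`
of fine bonds `Q^{s*}V = Q^{s*}W` as soon as `V = W` on the coarse bonds `⟨blockOf b₋, μ(b)⟩` of the non-interior `b ∈ S`.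
[cite: Balaban1988Convergent, (1.3) p.246] -/
theorem qsstarG_local [One G] {j : ℕ} (S : Set (PBond P j)) (V W : GaugeField P (j + 1) G)
    (h : ∀ b ∈ S, blockOf b.tgt ≠ blockOf b.src → V ⟨blockOf b.src, b.dir⟩ = W ⟨blockOf b.src, b.dir⟩) :
    ∀ b ∈ S, qsstarG V b = qsstarG W b := by
  intro b hb
  rw [qsstarG_apply, qsstarG_apply]
  by_cases hi : blockOf b.tgt = blockOf b.src
  · rw [if_pos hi, if_pos hi]
  · rw [if_neg hi, if_neg hi]
    exact h b hb hi

/-- Pointwise form: `(Q^{s*}V)(b)` depends on `V` through the single value `V⟨blockOf b₋, μ(b)⟩`.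
[cite: Balaban1988Convergent, (1.3) p.246] -/
theorem qsstarG_congr_bond [One G] {j : ℕ} (V W : GaugeField P (j + 1) G) (b : PBond P j)
    (h : V ⟨blockOf b.src, b.dir⟩ = W ⟨blockOf b.src, b.dir⟩) : qsstarG V b = qsstarG W b :=
  qsstarG_local {b} V W (fun _ hb _ => by rw [Set.mem_singleton_iff.1 hb]; exact h) b rfl

/-! ## §2. The p. 246 sentence with locality (c) discharged -/

/-- `U1locDependsOn` is monotone in the bond sets: dependence through `V↾vars` implies dependence through `V↾vars′` for any
`vars ⊆ vars′` (in particular through `V↾□′^{∼4}` once `vars □′ ⊆` the bonds of `□′^{∼4}`). [cite: Balaban1988Convergent, (1.2) p.246] -/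
theorem u1locDependsOn_mono [GaugeGroup G] (D : Sect1Data P G) {vars vars' : D.Cube1 → Set (PBond P 1)}
    (hle : ∀ c, vars c ⊆ vars' c) (h : U1locDependsOn D vars) : U1locDependsOn D vars' :=
  fun c V W hVW => h c V W (fun b hb => hVW b (hle c hb))

/-- **p. 246, locality (c) CONCRETE**: for section-1 data whose `Q₁^{s*}` is the printed (1.3) (`D.Qsstar = qsstarG`), and the
localities (a) of `U(𝐁, ·)` and (b) of `M˙` as in `u1locDependsOn_of_local`, the function (1.2) depends on `V` only through its
values on the coarse bonds `⟨blockOf b₋, μ(b)⟩` of the non-interior fine bonds `b` of the region `fine □′` (the fine bonds of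
`□′^{∼4}`). [cite: Balaban1988Convergent, (1.2) p.246] -/
theorem u1locDependsOn_of_qsstarG [GaugeGroup G] (D : Sect1Data P G) (fine : D.Cube1 → Set (PBond P 0))
    (agree : D.DetSet → D.BData → D.BData → Prop)
    (hU : ∀ (S : D.DetSet) (β β' : D.BData), agree S β β' → D.Umap S β = D.Umap S β')
    (hM : ∀ (c : D.Cube1) (U U' : GaugeField P 0 G),
      (∀ b ∈ fine c, U b = U' b) → agree (D.B1enl4 c) (D.Mdot U) (D.Mdot U'))
    (hD : ∀ V, D.Qsstar V = qsstarG (j := 0) V) :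
    U1locDependsOn D (fun c =>
      {c' | ∃ b ∈ fine c, blockOf b.tgt ≠ blockOf b.src ∧ c' = ⟨blockOf b.src, b.dir⟩}) :=
  u1locDependsOn_of_local D _ fine agree hU hM fun c V W hVW b hb => by
    rw [hD, hD]
    exact qsstarG_local (fine c) V W (fun b' hb' hi => hVW _ ⟨b', hb', hi, rfl⟩) b hb

/-- The same for any family of bond sets containing those coarse bonds — e.g. `vars □′ =` all `T^{(1)}`-bonds of `□′^{∼4}`, which
is the printed reading *"depends on the field V restricted to □′^{∼4}"*. [cite: Balaban1988Convergent, (1.2) p.246] -/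
theorem u1locDependsOn_of_qsstarG_of_subset [GaugeGroup G] (D : Sect1Data P G) (fine : D.Cube1 → Set (PBond P 0))
    (vars : D.Cube1 → Set (PBond P 1))
    (hvars : ∀ c, ∀ b ∈ fine c, blockOf b.tgt ≠ blockOf b.src → (⟨blockOf b.src, b.dir⟩ : PBond P 1) ∈ vars c)
    (agree : D.DetSet → D.BData → D.BData → Prop)
    (hU : ∀ (S : D.DetSet) (β β' : D.BData), agree S β β' → D.Umap S β = D.Umap S β')
    (hM : ∀ (c : D.Cube1) (U U' : GaugeField P 0 G),
      (∀ b ∈ fine c, U b = U' b) → agree (D.B1enl4 c) (D.Mdot U) (D.Mdot U'))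
    (hD : ∀ V, D.Qsstar V = qsstarG (j := 0) V) : U1locDependsOn D vars := by
  refine u1locDependsOn_mono D (fun c => ?_) (u1locDependsOn_of_qsstarG D fine agree hU hM hD)
  rintro c' ⟨b, hb, hi, rfl⟩
  exact hvars c b hb hi

end Literature.MathematicalPhysics.QuantumFieldTheory.Balaban1983to89.B14.Eq12LocalityQsstar
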